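import Literature.Analysis.FluidPDE.OnsagerBDSVGradedNorms
import Literature.Analysis.FluidPDE.OnsagerBDSVDeformationBoundsProofs
import Literature.Analysis.FluidPDE.OnsagerBDSVRhoQDeriv
import Literature.Analysis.FluidPDE.OnsagerBDSVMaterialLeibniz
import Literature.Analysis.FluidPDE.OnsagerBDSVEnergyCrossTerm
import HarnessLib

/-!
# The BDSV perturbation: proof of `‖D_{t,q} R̃_{q,i}‖_N ≲ τ_q⁻¹ ℓ^{-N}` (Prop. 5.9, arXiv (5.38))

Buckmaster–De Lellis–Székelyhidi–Vicol (BDSV), *Onsager's conjecture for admissible weak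
solutions*, CPAM 72 (2019) = arXiv:1701.08678, Prop. 5.9, second item (arXiv (5.38)): for
`t ∈ Ĩ_i` and `N ≥ 0`, `‖D_{t,q} R̃_{q,i}‖_N ≲ τ_q^{-1} ℓ^{-N}`, `D_{t,q} = ∂ₜ + v̄_q·∇`. The printed
proof (§5.5): `D_{t,q}∇Φ_i = -∇Φ_i Dv̄_q`, so that (arXiv (5.37)) `‖D_{t,q}∇Φ_i‖_N ≲ δ_q^{1/2}λ_qℓ^{-N}`
by (2.19) and (5.23); (arXiv (5.27)) `R_{q,i}/ρ_{q,i} = Id - (∑_j∫η_j²/ρ_q) R̊̄_q`, whose material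
derivative (arXiv (5.41)) is bounded (arXiv (5.42)) by
`δ_{q+1}^{-1}δ_q^{1/2}λ_q^{1+2α}‖R̊̄_q‖_N + τ_q^{-1}δ_{q+1}^{-1}λ_q^α‖R̊̄_q‖_N + δ_{q+1}^{-1}λ_q^α‖D_{t,q}R̊̄_q‖_N
 ≲ τ_q^{-1}ℓ^{-N}` using (2.20), (2.21), (5.15) and (5.18); and finally the Leibniz expansion
`D_{t,q}R̃_{q,i} = D_{t,q}∇Φ_i (ρ_{q,i}⁻¹R_{q,i}) ∇Φ_iᵀ + ∇Φ_i D_{t,q}(ρ_{q,i}⁻¹R_{q,i}) ∇Φ_iᵀ +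
∇Φ_i (ρ_{q,i}⁻¹R_{q,i}) (D_{t,q}∇Φ_i)ᵀ` with (5.23), (5.37), (5.28), (5.42).

This file PROVES the named fact `BDSV.tildeRTransportBound` of `OnsagerBDSVDeformationBounds.lean`
(`BDSV.tildeRTransportBound_holds`) along these lines, in the scale-graded bookkeeping
`BDSV.GradedSupLE` (`OnsagerBDSVGradedNorms.lean`):

* graded forms of (2.19)–(2.21) (`PerturbationHypotheses.gradedSupLE_gradField_vbar`, `…_clm_Rbar`,
  `…_clm_advectiveDeriv_Rbar`);
* the window `[max(0,t_i-τ_q/3), min(T,t_{i+1}+τ_q/3)] ⊇ Ĩ_i` (`BDSV.tildeInterval_window`) on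
  which the all-orders displacement bound `BDSV.displacement_allOrders` applies, and the graded
  bounds it yields for `∇Φ_i` (amplitude `18`), `∇D_i` (amplitude `1`) and, through
  `D_{t,q}∇Φ_i = jac(-∇v̄_q - ∇D_i∘∇v̄_q)`, for `D_{t,q}∇Φ_i` (arXiv (5.37));
* with `∑_j∫η_j² = 1` on `supp R̊̄_q` (`OnsagerBDSVRhoQDeriv.lean`), the normalised stress is
  `M = Id - ρ_q⁻¹ R̊̄_q` on `[0,T]`; graded bounds for `M` and
  `D_{t,q}M = -((ρ_q⁻¹)' R̊̄_q + ρ_q⁻¹ D_{t,q}R̊̄_q)` (arXiv (5.41)–(5.42)), from (5.15), (5.18),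
  (2.20), (2.21);
* the Leibniz expansion of `D_{t,q}(∇Φ_i M ∇Φ_iᵀ)` and its graded bound; the parameter step
  `δ_q^{1/2}λ_q ≤ τ_q⁻¹ = δ_q^{1/2}λ_qℓ^{-2α}`, `λ_q^αℓ^α ≤ 1`, `λ_q^α ≤ ℓ^{-α}`, `δ_{q+1}⁻¹ ≤ δ_q^{1/2}λ_q`
  (for `b < (1-β)/(2β)` and `a` large; this is where `|e'| ≤ 1 ≲ δ_{q+1}δ_q^{1/2}λ_q` enters);
* the assembly along the quantifier prefix of the fact (`α₀ = 2βb(b-1)`, `N̄ = N`).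

## References

* T. Buckmaster, C. De Lellis, L. Székelyhidi Jr., V. Vicol, *Onsager's conjecture for admissible
  weak solutions*, Comm. Pure Appl. Math. 72 (2019) 229–274 = arXiv:1701.08678, §5.5 Prop. 5.9
  (arXiv (5.37)–(5.38)) and its proof (arXiv (5.40)–(5.42)); Prop. 5.7 (arXiv (5.23), (5.27));
  Lemma 5.4 (arXiv (5.15), (5.18)); §2.5 (2.16)–(2.21); App. A (A.2); App. B Prop. B.1.
  Equation numbers as in arXiv:1701.08678v1.
-/

open MeasureTheory Set
open scoped NNReal ENNReal ContDiff Matrix Matrix.Norms.Elementwise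

noncomputable section

namespace Literature.Analysis.FluidPDE

namespace BDSV

open FunctionSpaces FunctionSpaces.Torus

/-! ## Graded forms of the standing estimates (2.19)–(2.21) -/

section Inputs

variable {P : Params} {S : Setting} {Nbar N : ℕ} {Cin C₀ : ℝ}

/-- **(2.19), graded**: `‖∇v̄_q(t)‖_{j,0} ≤ (C_in δ_q^{1/2} λ_q) ℓ^{-j}` for `j ≤ N ≤ N̄`, `t ∈ [0,T]`
(`‖∇v̄_q‖_j ≤ ‖v̄_q‖_{j+1}`). [cite: BuckmasterEtAl2018, §2.5 (2.19)] -/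
theorem PerturbationHypotheses.gradedSupLE_gradField_vbar (H : PerturbationHypotheses P S Nbar Cin C₀)
    (hN : N ≤ Nbar) :
    GradedSupLE (Icc 0 S.T) (gradField S.vbar) N
      (Cin * (Real.sqrt (amp P.β P.a P.b S.q) * freq P.a P.b S.q)) (mollScale P.β P.α P.a P.b S.q) := by
  refine gradedSupLE_fderiv_of_succ fun j hj t ht => ?_
  refine (H.velocity j (hj.trans hN) t ht).trans (le_of_eq ?_)
  congr 1
  ring

/-- **(2.20), graded, through a continuous linear map of the columns**: for `C_in ≥ 0`,
`‖L(R̊̄_q(t))‖_{j,0} ≤ ‖L‖ · 3 C_in δ_{q+1} ℓ^α · ℓ^{-j}` for `j ≤ N ≤ N̄` (`‖·‖_{j,0} ≤ 3‖·‖_{j,α}`).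
[cite: BuckmasterEtAl2018, §2.5 (2.20)] -/
theorem PerturbationHypotheses.gradedSupLE_clm_Rbar (H : PerturbationHypotheses P S Nbar Cin C₀)
    (ha : 1 ≤ P.a) (hN : N ≤ Nbar) {Z : Type*} [NormedAddCommGroup Z] [NormedSpace ℝ Z]
    (L : (Fin 3 → EuclideanSpace ℝ (Fin 3)) →L[ℝ] Z) :
    GradedSupLE (Icc 0 S.T) (fun t x => L (S.Rbar t x)) N
      (‖L‖ * (3 * (Cin * (amp P.β P.a P.b (S.q + 1) * mollScale P.β P.α P.a P.b S.q ^ P.α))))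
      (mollScale P.β P.α P.a P.b S.q) := by
  have hℓ := mollScale_pos (β := P.β) (α := P.α) (b := P.b) ha S.q
  have hR : GradedSupLE (Icc 0 S.T) S.Rbar N
      (3 * (Cin * (amp P.β P.a P.b (S.q + 1) * mollScale P.β P.α P.a P.b S.q ^ P.α)))
      (mollScale P.β P.α P.a P.b S.q) := by
    refine gradedSupLE_of_holder (r := Real.toNNReal P.α) fun j hj t ht => ?_
    refine (H.stress j (hj.trans hN) t ht).trans (le_of_eq ?_)
    congr 1
    rw [Real.rpow_add hℓ]
    ring
  exact hR.clm (fun t ht => H.eulerReynolds.smooth_stress.isSmooth_slice ht) L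

/-- **(2.21), graded, through a continuous linear map of the columns**: for `C_in ≥ 0`,
`‖L(D_{t,q}R̊̄_q(t))‖_{j,0} ≤ ‖L‖ · 3 C_in δ_{q+1} δ_q^{1/2} λ_q ℓ^{-α} · ℓ^{-j}` for `j ≤ N ≤ N̄`.
[cite: BuckmasterEtAl2018, §2.5 (2.21)] -/
theorem PerturbationHypotheses.gradedSupLE_clm_advectiveDeriv_Rbar
    (H : PerturbationHypotheses P S Nbar Cin C₀) (ha : 1 ≤ P.a) (hN : N ≤ Nbar)
    {Z : Type*} [NormedAddCommGroup Z] [NormedSpace ℝ Z]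
    (L : (Fin 3 → EuclideanSpace ℝ (Fin 3)) →L[ℝ] Z) :
    GradedSupLE (Icc 0 S.T) (fun t x => L (advectiveDeriv S.T S.vbar S.Rbar t x)) N
      (‖L‖ * (3 * (Cin * (amp P.β P.a P.b (S.q + 1) * Real.sqrt (amp P.β P.a P.b S.q) *
        freq P.a P.b S.q * mollScale P.β P.α P.a P.b S.q ^ (-P.α)))))
      (mollScale P.β P.α P.a P.b S.q) := by
  have hℓ := mollScale_pos (β := P.β) (α := P.α) (b := P.b) ha S.q
  have hR : GradedSupLE (Icc 0 S.T) (advectiveDeriv S.T S.vbar S.Rbar) N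
      (3 * (Cin * (amp P.β P.a P.b (S.q + 1) * Real.sqrt (amp P.β P.a P.b S.q) *
        freq P.a P.b S.q * mollScale P.β P.α P.a P.b S.q ^ (-P.α))))
      (mollScale P.β P.α P.a P.b S.q) := by
    refine gradedSupLE_of_holder (r := Real.toNNReal P.α) fun j hj t ht => ?_
    refine (H.transport j (hj.trans hN) t ht).trans (le_of_eq ?_)
    congr 1
    rw [sub_eq_add_neg, Real.rpow_add hℓ]
    ring
  exact hR.clm (fun t ht => isSmooth_advectiveDeriv_slice H.pos_T H.eulerReynolds.smooth_velocity
    H.eulerReynolds.smooth_stress ht) L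

end Inputs

/-! ## The matrix plumbing on the coordinate carrier `Fin 3 → Fin 3 → ℝ`

The continuous (bi)linear maps of `OnsagerBDSVMaterialLeibniz.lean`, re-typed over the coordinate
space of the entries (`Matrix (Fin 3) (Fin 3) ℝ` is by definition `Fin 3 → Fin 3 → ℝ`, with the
same — elementwise sup — norm): on this carrier the operator norms `‖B‖` of the Leibniz constants
are available without instance bookkeeping. -/

section PiMaps

/-- Matrix multiplication as a continuous bilinear map on `Fin 3 → Fin 3 → ℝ`. [folklore] -/
theorem exists_matrixMulCLM_pi : ∃ B : (Fin 3 → Fin 3 → ℝ) →L[ℝ] (Fin 3 → Fin 3 → ℝ) →L[ℝ] (Fin 3 → Fin 3 → ℝ),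
    ∀ X Y : Matrix (Fin 3) (Fin 3) ℝ, B X Y = (X * Y : Matrix (Fin 3) (Fin 3) ℝ) := by
  obtain ⟨B, hB⟩ := exists_matrixMulCLM
  exact ⟨B, hB⟩

/-- The transpose as a continuous linear map on `Fin 3 → Fin 3 → ℝ`. [folklore] -/
theorem exists_transposeCLM_pi : ∃ L : (Fin 3 → Fin 3 → ℝ) →L[ℝ] (Fin 3 → Fin 3 → ℝ),
    ∀ X : Matrix (Fin 3) (Fin 3) ℝ, L X = (Xᵀ : Matrix (Fin 3) (Fin 3) ℝ) := by
  obtain ⟨L, hL⟩ := exists_transposeCLM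
  exact ⟨L, hL⟩

/-- `BDSV.ofCols` as a continuous linear map into `Fin 3 → Fin 3 → ℝ`. [folklore] -/
theorem exists_ofColsCLM_pi : ∃ L : (Fin 3 → EuclideanSpace ℝ (Fin 3)) →L[ℝ] (Fin 3 → Fin 3 → ℝ),
    ∀ S : Fin 3 → EuclideanSpace ℝ (Fin 3), L S = (ofCols S : Matrix (Fin 3) (Fin 3) ℝ) := by
  obtain ⟨L, hL⟩ := exists_ofColsCLM
  exact ⟨L, hL⟩

/-- The Jacobian-matrix map into `Fin 3 → Fin 3 → ℝ`. [folklore] -/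
theorem exists_jacCLM_pi : ∃ L : (EuclideanSpace ℝ (Fin 3) →L[ℝ] EuclideanSpace ℝ (Fin 3)) →L[ℝ] (Fin 3 → Fin 3 → ℝ),
    ∀ (φ : EuclideanSpace ℝ (Fin 3) →L[ℝ] EuclideanSpace ℝ (Fin 3)) (a b : Fin 3),
      L φ a b = φ (EuclideanSpace.single b 1) a := by
  obtain ⟨L, hL⟩ := exists_jacCLM
  exact ⟨L, hL⟩

end PiMaps

/-! ## The window around `Ĩ_i` and the graded bounds for `∇Φ_i`, `∇D_i`, `D_{t,q}∇Φ_i` -/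

section Window

/-- **The window `[max(0, t_i - τ/3), min(T, t_{i+1} + τ/3)] ⊇ Ĩ_i`** (nonempty `Ĩ_i`, `T, τ > 0`):
it is a nondegenerate subinterval of `[0,T]` of length `≤ 5τ/3` containing `Ĩ_i` and the anchor
`min(t_i, T)` of `Φ_i`. [cite: BuckmasterEtAl2018, §5.2 (iv) and the definition of Ĩ_i] -/
theorem tildeInterval_window {T τ : ℝ} (hT : 0 < T) (hτ : 0 < τ) (i : ℕ) {t : ℝ}
    (ht : t ∈ tildeInterval T τ i) :
    max 0 ((i : ℝ) * τ - τ / 3) < min T (((i : ℝ) + 1) * τ + τ / 3) ∧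
      Icc (max 0 ((i : ℝ) * τ - τ / 3)) (min T (((i : ℝ) + 1) * τ + τ / 3)) ⊆ Icc 0 T ∧
      min ((i : ℝ) * τ) T ∈ Icc (max 0 ((i : ℝ) * τ - τ / 3)) (min T (((i : ℝ) + 1) * τ + τ / 3)) ∧
      min T (((i : ℝ) + 1) * τ + τ / 3) - max 0 ((i : ℝ) * τ - τ / 3) ≤ 5 / 3 * τ ∧
      tildeInterval T τ i ⊆ Icc (max 0 ((i : ℝ) * τ - τ / 3)) (min T (((i : ℝ) + 1) * τ + τ / 3)) := by
  obtain ⟨ht0, ht1⟩ := ht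
  have hi0 : 0 ≤ (i : ℝ) * τ := mul_nonneg i.cast_nonneg hτ.le
  refine ⟨?_, ?_, ?_, ?_, ?_⟩
  · refine max_lt (lt_min hT (by linarith [ht1.2, ht0.1])) (lt_min (by linarith [ht1.1, ht0.2]) ?_)
    nlinarith
  · exact fun s hs => ⟨(le_max_left _ _).trans hs.1, hs.2.trans (min_le_left _ _)⟩
  · exact ⟨max_le (le_min hi0 hT.le) (le_min (by linarith) (by linarith [ht1.1, ht0.2])),
      le_min (min_le_right _ _) ((min_le_left _ _).trans (by nlinarith))⟩
  · have h1 : min T (((i : ℝ) + 1) * τ + τ / 3) ≤ ((i : ℝ) + 1) * τ + τ / 3 := min_le_right _ _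
    have h2 : (i : ℝ) * τ - τ / 3 ≤ max 0 ((i : ℝ) * τ - τ / 3) := le_max_right _ _
    nlinarith
  · exact fun s hs => ⟨max_le hs.1.1 hs.2.1.le, le_min hs.1.2 hs.2.2.le⟩

variable {T : ℝ} {v : ℝ → UnitAddTorus (Fin 3) → EuclideanSpace ℝ (Fin 3)}
  {D : ℕ → ℝ → UnitAddTorus (Fin 3) → EuclideanSpace ℝ (Fin 3)} {i N : ℕ} {J : Set ℝ} {ℓ : ℝ}

/-- **`∇Φ_i` graded from the displacement bound**: if `‖D_i(s)‖_{n+1,0} ≤ ℓ^{-n}` for `s ∈ J`,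
`n ≤ N` (`0 < ℓ ≤ 1`), then `‖∇Φ_i(s)‖_{j,0} ≤ 18 ℓ^{-j}` (`‖∇Φ_i‖_j ≤ 9(1 + ‖D_i‖_{j+1})`).
[cite: BuckmasterEtAl2018, Prop. 5.7 (arXiv (5.23))] -/
theorem gradedSupLE_gradPhi_of_disp (hℓ : 0 < ℓ) (hℓ1 : ℓ ≤ 1) (hDs : ∀ s ∈ J, IsSmooth (D i s))
    (hDb : ∀ s ∈ J, ∀ n ≤ N,
      Torus.eContDiffHolderNorm (n + 1) 0 (D i s) ≤ ENNReal.ofReal (ℓ ^ (-(n : ℝ)))) :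
    GradedSupLE J (fun s x => gradPhi D i s x) N 18 ℓ := by
  intro j hj s hs
  refine (eContDiffHolderNorm_gradPhi_le (hDs s hs) j 0).trans ?_
  have hw : (1 : ℝ) ≤ ℓ ^ (-(j : ℝ)) := one_le_rpow_neg_nat hℓ hℓ1 j
  have hw0 : (0 : ℝ) ≤ ℓ ^ (-(j : ℝ)) := zero_le_one.trans hw
  calc (9 : ℝ≥0∞) * (1 + Torus.eContDiffHolderNorm (j + 1) 0 (D i s))
      ≤ 9 * (1 + ENNReal.ofReal (ℓ ^ (-(j : ℝ)))) := by gcongr; exact hDb s hs j hj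
    _ = ENNReal.ofReal (9 * (1 + ℓ ^ (-(j : ℝ)))) := by
        rw [ENNReal.ofReal_mul (by norm_num), ENNReal.ofReal_ofNat, ENNReal.ofReal_add zero_le_one hw0,
          ENNReal.ofReal_one]
    _ ≤ ENNReal.ofReal (18 * ℓ ^ (-(j : ℝ))) := ENNReal.ofReal_le_ofReal (by nlinarith)

/-- **`∇D_i` graded from the displacement bound**: `‖∇D_i(s)‖_{j,0} ≤ ℓ^{-j}`. [folklore] -/
theorem gradedSupLE_gradField_of_disp
    (hDb : ∀ s ∈ J, ∀ n ≤ N,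
      Torus.eContDiffHolderNorm (n + 1) 0 (D i s) ≤ ENNReal.ofReal (ℓ ^ (-(n : ℝ)))) :
    GradedSupLE J (gradField (D i)) N 1 ℓ := by
  refine gradedSupLE_fderiv_of_succ fun j hj s hs => ?_
  rw [one_mul]
  exact hDb s hs j hj

/-- **`D_{t,q}∇Φ_i` graded** (arXiv (5.37): "`‖D_{t,q}∇Φ_i‖_N ≲ δ_q^{1/2}λ_qℓ^{-N}`"): from
`D_{t,q}∇Φ_i = jac(-∇v̄ - ∇D_i∘∇v̄)` and graded bounds `Λ` for `∇v̄`, `1` for `∇D_i` on `J ⊆ [0,T]`,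
the graded bound `‖jac‖ (Λ + 3ᴺ(N+1)‖compL‖ Λ)` for `D_{t,q}∇Φ_i`.
[cite: BuckmasterEtAl2018, Prop. 5.9 (arXiv (5.37))] -/
theorem gradedSupLE_advectiveDeriv_gradPhi (hT : 0 < T)
    {L : (EuclideanSpace ℝ (Fin 3) →L[ℝ] EuclideanSpace ℝ (Fin 3)) →L[ℝ] (Fin 3 → Fin 3 → ℝ)}
    (hL : ∀ (φ : EuclideanSpace ℝ (Fin 3) →L[ℝ] EuclideanSpace ℝ (Fin 3)) (a b : Fin 3),
      L φ a b = φ (EuclideanSpace.single b 1) a)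
    (hv : Torus.IsSmoothSpaceTimeOn (Icc 0 T) v) (hD : Torus.IsSmoothSpaceTimeOn (Icc 0 T) (D i))
    (htr : ∀ s ∈ Icc 0 T, ∀ x, advectiveDeriv T v (D i) s x = -v s x) (hJ : J ⊆ Icc 0 T)
    (hℓ : 0 < ℓ) {Λ : ℝ} (hΛ : 0 ≤ Λ) (hvg : GradedSupLE J (gradField v) N Λ ℓ)
    (hDg : GradedSupLE J (gradField (D i)) N 1 ℓ) :
    GradedSupLE J (advectiveDeriv T v (fun s y => gradPhi D i s y)) N
      (‖L‖ * (Λ + 3 ^ N * (N + 1) *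
        ‖ContinuousLinearMap.compL ℝ (EuclideanSpace ℝ (Fin 3)) (EuclideanSpace ℝ (Fin 3))
          (EuclideanSpace ℝ (Fin 3))‖ * 1 * Λ)) ℓ := by
  have hvs : ∀ s ∈ J, IsSmooth (gradField v s) := fun s hs => (hv.isSmooth_slice (hJ hs)).fderiv_slice
  have hDs' : ∀ s ∈ J, IsSmooth (gradField (D i) s) := fun s hs =>
    (hD.isSmooth_slice (hJ hs)).fderiv_slice
  -- the explicit field `jac(-∇v - ∇D ∘ ∇v)`
  have hcomp : GradedSupLE J (fun s y => (gradField (D i) s y).comp (gradField v s y)) N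
      (3 ^ N * (N + 1) *
        ‖ContinuousLinearMap.compL ℝ (EuclideanSpace ℝ (Fin 3)) (EuclideanSpace ℝ (Fin 3))
          (EuclideanSpace ℝ (Fin 3))‖ * 1 * Λ) ℓ :=
    (hDg.bilinear (ContinuousLinearMap.compL ℝ (EuclideanSpace ℝ (Fin 3)) (EuclideanSpace ℝ (Fin 3))
      (EuclideanSpace ℝ (Fin 3))) hvg hDs' hvs zero_le_one hΛ hℓ).congr
      fun _ _ _ => rfl
  have hcs : ∀ s ∈ J, IsSmooth (fun y => (gradField (D i) s y).comp (gradField v s y)) :=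
    fun s hs => isSmooth_clm_comp_slice (hDs' s hs) (hvs s hs)
  have hfs : ∀ s ∈ J, IsSmooth (fun y => -gradField v s y - (gradField (D i) s y).comp (gradField v s y)) :=
    fun s hs => ((hvs s hs).neg).sub (hcs s hs)
  have hc0 : 0 ≤ 3 ^ N * (N + 1) *
      ‖ContinuousLinearMap.compL ℝ (EuclideanSpace ℝ (Fin 3)) (EuclideanSpace ℝ (Fin 3))
        (EuclideanSpace ℝ (Fin 3))‖ * 1 * Λ :=
    mul_nonneg (mul_nonneg (by positivity) zero_le_one) hΛ
  have hfield := (hvg.neg.sub hcomp (fun s hs => (hvs s hs).neg) hcs hΛ hc0 hℓ).clm hfs L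
  refine hfield.congr fun s hs y => ?_
  exact (advectiveDeriv_gradPhi_eq hT hL hv hD htr (hJ hs) y).symm

end Window

/-! ## The normalised stress `M = Id - ρ_q⁻¹ R̊̄_q` and its material derivative -/

section Stress

variable {T : ℝ} {v : ℝ → UnitAddTorus (Fin 3) → EuclideanSpace ℝ (Fin 3)}
  {R : ℝ → UnitAddTorus (Fin 3) → Fin 3 → EuclideanSpace ℝ (Fin 3)} {N : ℕ} {ℓ : ℝ}

/-- Joint smoothness of a continuous bilinear expression of two jointly smooth fields. [folklore] -/
theorem _root_.Literature.Analysis.FunctionSpaces.Torus.IsSmoothSpaceTimeOn.clm_bilinear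
    {E₁ E₂ G : Type*} [NormedAddCommGroup E₁] [NormedSpace ℝ E₁] [NormedAddCommGroup E₂]
    [NormedSpace ℝ E₂] [NormedAddCommGroup G] [NormedSpace ℝ G] {Sset : Set ℝ}
    {f : ℝ → UnitAddTorus (Fin 3) → E₁} {g : ℝ → UnitAddTorus (Fin 3) → E₂}
    (hf : Torus.IsSmoothSpaceTimeOn Sset f) (hg : Torus.IsSmoothSpaceTimeOn Sset g) (B : E₁ →L[ℝ] E₂ →L[ℝ] G) :
    Torus.IsSmoothSpaceTimeOn Sset (fun s y => B (f s y) (g s y)) :=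
  B.isBoundedBilinearMap.contDiff.comp_contDiffOn (hf.prodMk hg)

/-- Slices of a continuous bilinear expression of smooth slices are smooth. [folklore] -/
theorem _root_.Literature.Analysis.FunctionSpaces.Torus.IsSmooth.clm_bilinear
    {E₁ E₂ G : Type*} [NormedAddCommGroup E₁] [NormedSpace ℝ E₁] [NormedAddCommGroup E₂]
    [NormedSpace ℝ E₂] [NormedAddCommGroup G] [NormedSpace ℝ G]
    {f : UnitAddTorus (Fin 3) → E₁} {g : UnitAddTorus (Fin 3) → E₂}
    (hf : IsSmooth f) (hg : IsSmooth g) (B : E₁ →L[ℝ] E₂ →L[ℝ] G) :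
    IsSmooth (fun y => B (f y) (g y)) :=
  B.isBoundedBilinearMap.contDiff.comp (ContDiff.prodMk hf hg)

/-- **The normalised stress `M = E₀ - θ(t) L(R̊̄_q)` is graded** with amplitude `‖E₀‖ + m A_R`
when `|θ| ≤ m` and `L(R̊̄_q)` has the graded bound `A_R` (`0 < ℓ ≤ 1`; `E₀` a constant matrix, the
identity in §5.5). [cite: BuckmasterEtAl2018, Prop. 5.7 (arXiv (5.28))] -/
theorem gradedSupLE_normStress {J : Set ℝ} {θ : ℝ → ℝ} {m A : ℝ} (E₀ : (Fin 3 → Fin 3 → ℝ))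
    {L : (Fin 3 → EuclideanSpace ℝ (Fin 3)) →L[ℝ] (Fin 3 → Fin 3 → ℝ)}
    (hℓ : 0 < ℓ) (hℓ1 : ℓ ≤ 1) (hRs : ∀ t ∈ J, IsSmooth (R t))
    (hRb : GradedSupLE J (fun t x => L (R t x)) N A ℓ) (hA : 0 ≤ A)
    (hθ : ∀ t ∈ J, |θ t| ≤ m) (hm : 0 ≤ m) :
    GradedSupLE J (fun t x => E₀ - θ t • L (R t x)) N (‖E₀‖ + m * A) ℓ := by
  have hLs : ∀ t ∈ J, IsSmooth (fun x => L (R t x)) := fun t ht => (hRs t ht).comp_clm L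
  have h1 := gradedSupLE_const J N E₀ hℓ hℓ1
  have h2 := hRb.time_smul hLs hθ
  exact h1.sub h2 (fun t _ => isSmooth_const _) (fun t ht => (hLs t ht).smul (θ t)) (norm_nonneg _)
    (mul_nonneg hm hA) hℓ

/-- **The material derivative of the normalised stress** (arXiv (5.41)):
`D_t (E₀ - θ(t) L(R̊̄)) = -(θ'(t) L(R̊̄) + θ(t) L(D_t R̊̄))` on `[0,T] × T³`, for `θ` smooth on `[0,T]`
with one-sided derivative `θ'`. [cite: BuckmasterEtAl2018, Prop. 5.9 (arXiv (5.41))] -/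
theorem advectiveDeriv_normStress_eq (hT : 0 < T) {θ θ' : ℝ → ℝ} (E₀ : (Fin 3 → Fin 3 → ℝ))
    (hθc : ContDiffOn ℝ ∞ θ (Icc 0 T)) (hθ : ∀ t ∈ Icc 0 T, HasDerivWithinAt θ (θ' t) (Icc 0 T) t)
    (L : (Fin 3 → EuclideanSpace ℝ (Fin 3)) →L[ℝ] (Fin 3 → Fin 3 → ℝ))
    (hR : Torus.IsSmoothSpaceTimeOn (Icc 0 T) R) {t : ℝ} (ht : t ∈ Icc 0 T) (x : UnitAddTorus (Fin 3)) :
    advectiveDeriv T v (fun s y => E₀ - θ s • L (R s y)) t x =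
      -(θ' t • L (R t x) + θ t • L (advectiveDeriv T v R t x)) := by
  have hLR : Torus.IsSmoothSpaceTimeOn (Icc 0 T) (fun s y => L (R s y)) := hR.clm_comp L
  have hsm : Torus.IsSmoothSpaceTimeOn (Icc 0 T) (fun s y => θ s • L (R s y)) :=
    (isSmoothSpaceTimeOn_of_time hθc).smul hLR
  calc advectiveDeriv T v (fun s y => E₀ - θ s • L (R s y)) t x
      = -advectiveDeriv T v (fun s y => θ s • L (R s y)) t x :=
        advectiveDeriv_const_sub (v := v) hT E₀ hsm ht x
    _ = -(θ' t • L (R t x) + θ t • advectiveDeriv T v (fun s y => L (R s y)) t x) :=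
        congrArg Neg.neg (advectiveDeriv_time_smul (v := v) hT ht (hθ t ht) hLR x)
    _ = -(θ' t • L (R t x) + θ t • L (advectiveDeriv T v R t x)) :=
        congrArg (fun z => -(θ' t • L (R t x) + θ t • z)) (advectiveDeriv_clm_apply (v := v) hT hR L ht x)

/-- **`D_t M` graded** (arXiv (5.42)): with `|θ'| ≤ m'`, `|θ| ≤ m` on `[0,T]` and graded bounds
`A_R` for `L(R̊̄)`, `A_D` for `L(D_t R̊̄)`, the field `D_t(E₀ - θ L(R̊̄))` has the graded bound
`m' A_R + m A_D`. [cite: BuckmasterEtAl2018, Prop. 5.9 (arXiv (5.42))] -/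
theorem gradedSupLE_advectiveDeriv_normStress (hT : 0 < T) {θ θ' : ℝ → ℝ} {m m' A_R A_D : ℝ}
    (E₀ : (Fin 3 → Fin 3 → ℝ))
    (hθc : ContDiffOn ℝ ∞ θ (Icc 0 T)) (hθ : ∀ t ∈ Icc 0 T, HasDerivWithinAt θ (θ' t) (Icc 0 T) t)
    (L : (Fin 3 → EuclideanSpace ℝ (Fin 3)) →L[ℝ] (Fin 3 → Fin 3 → ℝ))
    (hv : Torus.IsSmoothSpaceTimeOn (Icc 0 T) v) (hR : Torus.IsSmoothSpaceTimeOn (Icc 0 T) R) (hℓ : 0 < ℓ)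
    (hRb : GradedSupLE (Icc 0 T) (fun t x => L (R t x)) N A_R ℓ) (hA_R : 0 ≤ A_R)
    (hDb : GradedSupLE (Icc 0 T) (fun t x => L (advectiveDeriv T v R t x)) N A_D ℓ) (hA_D : 0 ≤ A_D)
    (hm : ∀ t ∈ Icc 0 T, |θ t| ≤ m) (hm0 : 0 ≤ m) (hm' : ∀ t ∈ Icc 0 T, |θ' t| ≤ m') (hm'0 : 0 ≤ m') :
    GradedSupLE (Icc 0 T) (advectiveDeriv T v (fun s y => E₀ - θ s • L (R s y))) N
      (m' * A_R + m * A_D) ℓ := by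
  have hLs : ∀ t ∈ Icc 0 T, IsSmooth (fun x => L (R t x)) := fun t ht => (hR.isSmooth_slice ht).comp_clm L
  have hLDs : ∀ t ∈ Icc 0 T, IsSmooth (fun x => L (advectiveDeriv T v R t x)) := fun t ht =>
    (isSmooth_advectiveDeriv_slice hT hv hR ht).comp_clm L
  have h1 := hRb.time_smul hLs hm'
  have h2 := hDb.time_smul hLDs hm
  have h := (h1.add h2 (fun t ht => (hLs t ht).smul (θ' t)) (fun t ht => (hLDs t ht).smul (θ t))
    (mul_nonneg hm'0 hA_R) (mul_nonneg hm0 hA_D) hℓ).neg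
  refine h.congr fun t ht x => ?_
  exact (advectiveDeriv_normStress_eq hT E₀ hθc hθ L hR ht x).symm

end Stress

/-! ## The conjugated stress `∇Φ M ∇Φᵀ` and its material derivative -/

section Conjugation

variable {T : ℝ} {v : ℝ → UnitAddTorus (Fin 3) → EuclideanSpace ℝ (Fin 3)} {N : ℕ} {ℓ : ℝ}
  {G M : ℝ → UnitAddTorus (Fin 3) → (Fin 3 → Fin 3 → ℝ)}

/-- **Leibniz expansion of `D_t(G M Gᵀ)`** (BDSV: "Differentiating (5.17) we achieve
`D_{t,q}R̃_{q,i} = D_{t,q}∇Φ_i (ρ⁻¹R) ∇Φ_iᵀ + ∇Φ_i D_{t,q}(ρ⁻¹R) ∇Φ_iᵀ + ∇Φ_i (ρ⁻¹R)(D_{t,q}∇Φ_i)ᵀ`"),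
for jointly smooth matrix fields `G, M` on `[0,T] × T³`, with the product and the transpose as
continuous (bi)linear maps. [cite: BuckmasterEtAl2018, Prop. 5.9 (proof, display after arXiv (5.42))] -/
theorem advectiveDeriv_conj_eq (hT : 0 < T)
    (Bm : (Fin 3 → Fin 3 → ℝ) →L[ℝ] (Fin 3 → Fin 3 → ℝ) →L[ℝ] (Fin 3 → Fin 3 → ℝ))
    (Lt : (Fin 3 → Fin 3 → ℝ) →L[ℝ] (Fin 3 → Fin 3 → ℝ))
    (hG : Torus.IsSmoothSpaceTimeOn (Icc 0 T) G) (hM : Torus.IsSmoothSpaceTimeOn (Icc 0 T) M) {t : ℝ}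
    (ht : t ∈ Icc 0 T) (x : UnitAddTorus (Fin 3)) :
    advectiveDeriv T v (fun s y => Bm (Bm (G s y) (M s y)) (Lt (G s y))) t x =
      Bm (Bm (advectiveDeriv T v G t x) (M t x)) (Lt (G t x)) +
        Bm (Bm (G t x) (advectiveDeriv T v M t x)) (Lt (G t x)) +
        Bm (Bm (G t x) (M t x)) (Lt (advectiveDeriv T v G t x)) := by
  have hGM : Torus.IsSmoothSpaceTimeOn (Icc 0 T) (fun s y => Bm (G s y) (M s y)) := hG.clm_bilinear hM Bm
  have hLG : Torus.IsSmoothSpaceTimeOn (Icc 0 T) (fun s y => Lt (G s y)) := hG.clm_comp Lt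
  have h1 := advectiveDeriv_bilinear (v := v) hT Bm hGM hLG ht x
  have h2 := advectiveDeriv_bilinear (v := v) hT Bm hG hM ht x
  have h3 := advectiveDeriv_clm_apply (v := v) hT hG Lt ht x
  calc advectiveDeriv T v (fun s y => Bm (Bm (G s y) (M s y)) (Lt (G s y))) t x
      = Bm (advectiveDeriv T v (fun s y => Bm (G s y) (M s y)) t x) (Lt (G t x)) +
          Bm (Bm (G t x) (M t x)) (advectiveDeriv T v (fun s y => Lt (G s y)) t x) := h1
    _ = Bm (Bm (advectiveDeriv T v G t x) (M t x) + Bm (G t x) (advectiveDeriv T v M t x)) (Lt (G t x)) +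
          Bm (Bm (G t x) (M t x)) (Lt (advectiveDeriv T v G t x)) := by rw [h2, h3]
    _ = _ := by rw [Bm.map_add₂]

/-- **Graded bound for `D_t(G M Gᵀ)`** from graded bounds `A_G, A_dG, A_M, A_dM` for
`G, D_tG, M, D_tM` on `J ⊆ [0,T]` (graded Leibniz twice on each of the three terms).
[cite: BuckmasterEtAl2018, Prop. 5.9 (proof, last display: the bound for ‖D_{t,q}R̃_{q,i}‖_N)] -/
theorem gradedSupLE_advectiveDeriv_conj (hT : 0 < T)
    (Bm : (Fin 3 → Fin 3 → ℝ) →L[ℝ] (Fin 3 → Fin 3 → ℝ) →L[ℝ] (Fin 3 → Fin 3 → ℝ))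
    (Lt : (Fin 3 → Fin 3 → ℝ) →L[ℝ] (Fin 3 → Fin 3 → ℝ))
    (hv : Torus.IsSmoothSpaceTimeOn (Icc 0 T) v)
    (hG : Torus.IsSmoothSpaceTimeOn (Icc 0 T) G) (hM : Torus.IsSmoothSpaceTimeOn (Icc 0 T) M) {J : Set ℝ}
    (hJ : J ⊆ Icc 0 T) (hℓ : 0 < ℓ) {A_G A_dG A_M A_dM : ℝ} (hA_G : 0 ≤ A_G) (hA_dG : 0 ≤ A_dG)
    (hA_M : 0 ≤ A_M) (hA_dM : 0 ≤ A_dM) (hGb : GradedSupLE J G N A_G ℓ)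
    (hdGb : GradedSupLE J (advectiveDeriv T v G) N A_dG ℓ) (hMb : GradedSupLE J M N A_M ℓ)
    (hdMb : GradedSupLE J (advectiveDeriv T v M) N A_dM ℓ) :
    GradedSupLE J (advectiveDeriv T v (fun s y => Bm (Bm (G s y) (M s y)) (Lt (G s y)))) N
      (3 ^ N * (N + 1) * ‖Bm‖ * (3 ^ N * (N + 1) * ‖Bm‖ * A_dG * A_M) * (‖Lt‖ * A_G) +
        3 ^ N * (N + 1) * ‖Bm‖ * (3 ^ N * (N + 1) * ‖Bm‖ * A_G * A_dM) * (‖Lt‖ * A_G) +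
        3 ^ N * (N + 1) * ‖Bm‖ * (3 ^ N * (N + 1) * ‖Bm‖ * A_G * A_M) * (‖Lt‖ * A_dG)) ℓ := by
  -- smoothness of all slices on `J`
  have hGs : ∀ t ∈ J, IsSmooth (G t) := fun t ht => hG.isSmooth_slice (hJ ht)
  have hMs : ∀ t ∈ J, IsSmooth (M t) := fun t ht => hM.isSmooth_slice (hJ ht)
  have hdGs : ∀ t ∈ J, IsSmooth (advectiveDeriv T v G t) := fun t ht =>
    isSmooth_advectiveDeriv_slice hT hv hG (hJ ht)
  have hdMs : ∀ t ∈ J, IsSmooth (advectiveDeriv T v M t) := fun t ht =>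
    isSmooth_advectiveDeriv_slice hT hv hM (hJ ht)
  have hLGs : ∀ t ∈ J, IsSmooth (fun y => Lt (G t y)) := fun t ht => (hGs t ht).comp_clm Lt
  have hLdGs : ∀ t ∈ J, IsSmooth (fun y => Lt (advectiveDeriv T v G t y)) := fun t ht =>
    (hdGs t ht).comp_clm Lt
  have hP : 0 ≤ (3 : ℝ) ^ N * (N + 1) * ‖Bm‖ := by positivity
  have hLt0 : 0 ≤ ‖Lt‖ := norm_nonneg _
  have hi1 : 0 ≤ 3 ^ N * (N + 1) * ‖Bm‖ * A_dG * A_M := mul_nonneg (mul_nonneg hP hA_dG) hA_M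
  have hi2 : 0 ≤ 3 ^ N * (N + 1) * ‖Bm‖ * A_G * A_dM := mul_nonneg (mul_nonneg hP hA_G) hA_dM
  have hi3 : 0 ≤ 3 ^ N * (N + 1) * ‖Bm‖ * A_G * A_M := mul_nonneg (mul_nonneg hP hA_G) hA_M
  have ho1 : 0 ≤ 3 ^ N * (N + 1) * ‖Bm‖ * (3 ^ N * (N + 1) * ‖Bm‖ * A_dG * A_M) * (‖Lt‖ * A_G) :=
    mul_nonneg (mul_nonneg hP hi1) (mul_nonneg hLt0 hA_G)
  have ho2 : 0 ≤ 3 ^ N * (N + 1) * ‖Bm‖ * (3 ^ N * (N + 1) * ‖Bm‖ * A_G * A_dM) * (‖Lt‖ * A_G) :=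
    mul_nonneg (mul_nonneg hP hi2) (mul_nonneg hLt0 hA_G)
  have ho3 : 0 ≤ 3 ^ N * (N + 1) * ‖Bm‖ * (3 ^ N * (N + 1) * ‖Bm‖ * A_G * A_M) * (‖Lt‖ * A_dG) :=
    mul_nonneg (mul_nonneg hP hi3) (mul_nonneg hLt0 hA_dG)
  -- the factors
  have hLG := hGb.clm hGs Lt
  have hLdG := hdGb.clm hdGs Lt
  -- the three terms
  have h1 := ((hdGb.bilinear Bm hMb hdGs hMs hA_dG hA_M hℓ).bilinear Bm hLG
    (fun t ht => (hdGs t ht).clm_bilinear (hMs t ht) Bm) hLGs hi1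
    (mul_nonneg hLt0 hA_G) hℓ)
  have h2 := ((hGb.bilinear Bm hdMb hGs hdMs hA_G hA_dM hℓ).bilinear Bm hLG
    (fun t ht => (hGs t ht).clm_bilinear (hdMs t ht) Bm) hLGs hi2
    (mul_nonneg hLt0 hA_G) hℓ)
  have h3 := ((hGb.bilinear Bm hMb hGs hMs hA_G hA_M hℓ).bilinear Bm hLdG
    (fun t ht => (hGs t ht).clm_bilinear (hMs t ht) Bm) hLdGs hi3
    (mul_nonneg hLt0 hA_dG) hℓ)
  have h12 := h1.add h2
    (fun t ht => ((hdGs t ht).clm_bilinear (hMs t ht) Bm).clm_bilinear (hLGs t ht) Bm)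
    (fun t ht => ((hGs t ht).clm_bilinear (hdMs t ht) Bm).clm_bilinear (hLGs t ht) Bm)
    ho1 ho2 hℓ
  have h123 := h12.add h3
    (fun t ht => (((hdGs t ht).clm_bilinear (hMs t ht) Bm).clm_bilinear (hLGs t ht) Bm).add
      (((hGs t ht).clm_bilinear (hdMs t ht) Bm).clm_bilinear (hLGs t ht) Bm))
    (fun t ht => ((hGs t ht).clm_bilinear (hMs t ht) Bm).clm_bilinear (hLdGs t ht) Bm)
    (add_nonneg ho1 ho2) ho3 hℓ
  refine h123.congr fun t ht x => ?_
  exact (advectiveDeriv_conj_eq hT Bm Lt hG hM (hJ ht) x).symm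

end Conjugation

/-! ## Parameter inequalities -/

section Params

variable {β α a b : ℝ}

/-- `λ_q^α ℓ^α ≤ 1` (from (2.11), `ℓ ≤ λ_q⁻¹`). [cite: BuckmasterEtAl2018, §2.4 (2.11)] -/
theorem freq_rpow_mul_mollScale_rpow_le_one' (ha : 1 ≤ a) (hb : 1 ≤ b) (hβ : 0 ≤ β) (hα : 0 ≤ α)
    (q : ℕ) : freq a b q ^ α * mollScale β α a b q ^ α ≤ 1 := by
  have hf := freq_pos (b := b) ha q
  have h := mollScale_rpow_le (β := β) ha hb hβ hα q
  calc freq a b q ^ α * mollScale β α a b q ^ α ≤ freq a b q ^ α * freq a b q ^ (-α) :=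
        mul_le_mul_of_nonneg_left h (Real.rpow_nonneg hf.le _)
    _ = 1 := by rw [← Real.rpow_add hf, add_neg_cancel, Real.rpow_zero]

/-- `λ_q^α ≤ ℓ^{-α}` (from `ℓ ≤ λ_q⁻¹`). [cite: BuckmasterEtAl2018, §2.4 (2.11)] -/
theorem freq_rpow_le_mollScale_rpow_neg (ha : 1 ≤ a) (hb : 1 ≤ b) (hβ : 0 ≤ β) (hα : 0 ≤ α)
    (q : ℕ) : freq a b q ^ α ≤ mollScale β α a b q ^ (-α) := by
  have hf := freq_pos (b := b) ha q
  have hℓ := mollScale_pos (β := β) (α := α) (b := b) ha q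
  have h := mollScale_le_freq_inv (β := β) (α := α) ha hb hβ hα q
  calc freq a b q ^ α = ((freq a b q)⁻¹) ^ (-α) := by
        rw [Real.inv_rpow hf.le, Real.rpow_neg hf.le, inv_inv]
    _ ≤ mollScale β α a b q ^ (-α) := Real.rpow_le_rpow_of_nonpos hℓ h (by linarith)

/-- **`δ_{q+1}⁻¹ ≤ δ_q^{1/2} λ_q` for `a` large** when `b < (1-β)/(2β)` (the `a`-exponent of
`λ_{q+1}^{2β} λ_q^{β-1}` is `2βb - (1-β) < 0`); this is the inequality `1 ≲ δ_{q+1}δ_q^{1/2}λ_q`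
behind the absorption of `|e'| ≤ 1` into (5.18). [cite: BuckmasterEtAl2018, Lemma 5.4 (arXiv (5.18)) and §2.1 (b < (1-β)/(2β))] -/
theorem exists_threshold_amp_succ_inv_le (hβ : 0 < β) (hb1 : 1 < b) (hb2 : b < (1 - β) / (2 * β)) :
    ∃ a₁ : ℝ, 1 < a₁ ∧ ∀ a : ℝ, a₁ ≤ a → ∀ q : ℕ,
      (amp β a b (q + 1))⁻¹ ≤ Real.sqrt (amp β a b q) * freq a b q := by
  have h2β : 2 * β * b < 1 - β := by
    have h := (lt_div_iff₀ (by positivity : (0 : ℝ) < 2 * β)).1 hb2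
    linarith
  have hE : (β - 1) + b * (2 * β) + b ^ 2 * 0 < 0 := by nlinarith
  obtain ⟨a₁, ha₁, h⟩ := exists_freq_triple_le hb1.le hE 1
  refine ⟨a₁, ha₁, fun a ha q => ?_⟩
  have ha1 : (1 : ℝ) ≤ a := ha₁.le.trans ha
  have hf0 := freq_pos (b := b) ha1 q
  have hf1 := freq_pos (b := b) ha1 (q + 1)
  have key := h a ha q
  rw [Real.rpow_zero, mul_one, one_mul] at key
  -- `λ_q^{β-1} λ_{q+1}^{2β} ≤ 1` ⇒ `λ_{q+1}^{2β} ≤ λ_q^{1-β} = λ_q^{-β} λ_q`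
  rw [sqrt_amp ha1]
  unfold amp
  rw [← Real.rpow_neg hf1.le, show -(-2 * β) = 2 * β by ring]
  have e1 : freq a b q ^ (-β) * freq a b q = freq a b q ^ (1 - β) := by
    rw [show (1 : ℝ) - β = -β + 1 by ring, Real.rpow_add hf0, Real.rpow_one]
  rw [e1]
  have e2 : freq a b q ^ (β - 1) * freq a b q ^ (1 - β) = 1 := by
    rw [← Real.rpow_add hf0, show β - 1 + (1 - β) = 0 by ring, Real.rpow_zero]
  have h3 : 0 < freq a b q ^ (1 - β) := Real.rpow_pos_of_pos hf0 _
  calc freq a b (q + 1) ^ (2 * β) = freq a b q ^ (β - 1) * freq a b (q + 1) ^ (2 * β) *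
        freq a b q ^ (1 - β) := by
        rw [mul_comm (freq a b q ^ (β - 1)), mul_assoc, e2, mul_one]
    _ ≤ 1 * freq a b q ^ (1 - β) := mul_le_mul_of_nonneg_right key h3.le
    _ = freq a b q ^ (1 - β) := one_mul _

/-- The arithmetic of arXiv (5.42): with `L = λ_q^α`, `E = ℓ^α ∈ (0,1]`, `LE ≤ 1`, `L ≤ E⁻¹`,
`δ = δ_{q+1} > 0`, `W = δ_q^{1/2}λ_q ≥ δ⁻¹`, `C = C_in ≥ 0`, `c = ‖L_cols‖ ≥ 0`, the amplitude of
`D_t M` — `(1 + 6(Cδ E)(CW))/3 · (8L/δ)² · (c·3CδE) + (8L/δ) · (c·3CδW E⁻¹)` — is at most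
`(88 C + 384 C³) c · W (E⁻¹)²`. [cite: BuckmasterEtAl2018, Prop. 5.9 (arXiv (5.42))] -/
theorem normStressDeriv_amplitude_le {L E δ W C c : ℝ} (hL : 0 ≤ L) (hE : 0 < E) (hE1 : E ≤ 1)
    (hLE : L * E ≤ 1) (hLE' : L ≤ E⁻¹) (hδ : 0 < δ) (hW : δ⁻¹ ≤ W) (hC : 0 ≤ C) (hc : 0 ≤ c) :
    (1 + 6 * (C * (δ * E)) * (C * W)) / 3 * (8 * L / δ) ^ 2 * (c * (3 * (C * (δ * E)))) +
        8 * L / δ * (c * (3 * (C * (δ * W * E⁻¹)))) ≤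
      (88 * C + 384 * C ^ 3) * c * (W * E⁻¹ ^ 2) := by
  have hW0 : 0 ≤ W := (inv_pos.2 hδ).le.trans hW
  have hEi1 : 1 ≤ E⁻¹ := (one_le_inv₀ hE).2 hE1
  have hEi0 : 0 ≤ E⁻¹ := zero_le_one.trans hEi1
  have hδ0 : δ ≠ 0 := hδ.ne'
  have hE0 : E ≠ 0 := hE.ne'
  -- rewrite the two summands
  have e1 : (1 + 6 * (C * (δ * E)) * (C * W)) / 3 * (8 * L / δ) ^ 2 * (c * (3 * (C * (δ * E)))) =
      64 * C * c * (L ^ 2 * E) * δ⁻¹ + 384 * C ^ 3 * c * ((L * E) ^ 2 * W) := by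
    field_simp
    ring
  have e2 : 8 * L / δ * (c * (3 * (C * (δ * W * E⁻¹)))) = 24 * C * c * (L * E⁻¹ * W) := by
    field_simp
    ring
  rw [e1, e2]
  -- the three bounds
  have hLE2 : (L * E) ^ 2 ≤ 1 := by
    have h0 : 0 ≤ L * E := mul_nonneg hL hE.le
    nlinarith
  have b1 : L ^ 2 * E * δ⁻¹ ≤ W * E⁻¹ ^ 2 := by
    -- `L²E = (LE)·L ≤ L ≤ E⁻¹ ≤ E⁻²`, `δ⁻¹ ≤ W`
    have h1 : L ^ 2 * E ≤ E⁻¹ := by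
      calc L ^ 2 * E = (L * E) * L := by ring
        _ ≤ 1 * L := mul_le_mul_of_nonneg_right hLE hL
        _ = L := one_mul L
        _ ≤ E⁻¹ := hLE'
    have h2 : E⁻¹ ≤ E⁻¹ ^ 2 := by nlinarith
    calc L ^ 2 * E * δ⁻¹ ≤ E⁻¹ ^ 2 * W :=
          mul_le_mul (h1.trans h2) hW (inv_pos.2 hδ).le (by positivity)
      _ = W * E⁻¹ ^ 2 := mul_comm _ _
  have b2 : (L * E) ^ 2 * W ≤ W * E⁻¹ ^ 2 := by
    calc (L * E) ^ 2 * W ≤ 1 * W := mul_le_mul_of_nonneg_right hLE2 hW0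
      _ ≤ E⁻¹ ^ 2 * W := mul_le_mul_of_nonneg_right (by nlinarith) hW0
      _ = W * E⁻¹ ^ 2 := mul_comm _ _
  have b3 : L * E⁻¹ * W ≤ W * E⁻¹ ^ 2 := by
    calc L * E⁻¹ * W ≤ E⁻¹ * E⁻¹ * W :=
          mul_le_mul_of_nonneg_right (mul_le_mul_of_nonneg_right hLE' hEi0) hW0
      _ = W * E⁻¹ ^ 2 := by ring
  have hCc : 0 ≤ C * c := mul_nonneg hC hc
  have hC3c : 0 ≤ C ^ 3 * c := mul_nonneg (pow_nonneg hC 3) hc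
  calc 64 * C * c * (L ^ 2 * E) * δ⁻¹ + 384 * C ^ 3 * c * ((L * E) ^ 2 * W) +
        24 * C * c * (L * E⁻¹ * W)
      = 64 * (C * c) * (L ^ 2 * E * δ⁻¹) + 384 * (C ^ 3 * c) * ((L * E) ^ 2 * W) +
          24 * (C * c) * (L * E⁻¹ * W) := by ring
    _ ≤ 64 * (C * c) * (W * E⁻¹ ^ 2) + 384 * (C ^ 3 * c) * (W * E⁻¹ ^ 2) +
          24 * (C * c) * (W * E⁻¹ ^ 2) := by
        refine add_le_add (add_le_add ?_ ?_) ?_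
        · exact mul_le_mul_of_nonneg_left b1 (by positivity)
        · exact mul_le_mul_of_nonneg_left b2 (by positivity)
        · exact mul_le_mul_of_nonneg_left b3 (by positivity)
    _ = (88 * C + 384 * C ^ 3) * c * (W * E⁻¹ ^ 2) := by ring

/-- The final arithmetic: the three Leibniz terms, with amplitudes `c₁W` (for `D_t∇Φ`), `c₂`
(for `M`), `c₃ W X` (for `D_tM`, `X = ℓ^{-2α} ≥ 1`) and `18` (for `∇Φ`), sum to at most
`C_fin · W X = C_fin τ_q⁻¹`. [cite: BuckmasterEtAl2018, Prop. 5.9 (arXiv (5.38))] -/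
theorem conjDeriv_amplitude_le {Pm nt c₁ c₂ c₃ W X : ℝ} (hPm : 0 ≤ Pm) (hnt : 0 ≤ nt)
    (hc₁ : 0 ≤ c₁) (hc₂ : 0 ≤ c₂) (hc₃ : 0 ≤ c₃) (hW : 0 ≤ W) (hX : 1 ≤ X) :
    Pm * (Pm * (c₁ * W) * c₂) * (nt * 18) + Pm * (Pm * 18 * (c₃ * (W * X))) * (nt * 18) +
        Pm * (Pm * 18 * c₂) * (nt * (c₁ * W)) ≤
      (Pm * (Pm * c₁ * c₂) * (nt * 18) + Pm * (Pm * 18 * c₃) * (nt * 18) +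
        Pm * (Pm * 18 * c₂) * (nt * c₁)) * (W * X) := by
  have hWX : W ≤ W * X := le_mul_of_one_le_right hW hX
  have k1 : 0 ≤ Pm * (Pm * c₁ * c₂) * (nt * 18) := by positivity
  have k3 : 0 ≤ Pm * (Pm * 18 * c₂) * (nt * c₁) := by positivity
  have hc₃' := hc₃
  calc Pm * (Pm * (c₁ * W) * c₂) * (nt * 18) + Pm * (Pm * 18 * (c₃ * (W * X))) * (nt * 18) +
        Pm * (Pm * 18 * c₂) * (nt * (c₁ * W))
      = (Pm * (Pm * c₁ * c₂) * (nt * 18)) * W + (Pm * (Pm * 18 * c₃) * (nt * 18)) * (W * X) +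
          (Pm * (Pm * 18 * c₂) * (nt * c₁)) * W := by ring
    _ ≤ (Pm * (Pm * c₁ * c₂) * (nt * 18)) * (W * X) + (Pm * (Pm * 18 * c₃) * (nt * 18)) * (W * X) +
          (Pm * (Pm * 18 * c₂) * (nt * c₁)) * (W * X) :=
        add_le_add (add_le_add (mul_le_mul_of_nonneg_left hWX k1) le_rfl)
          (mul_le_mul_of_nonneg_left hWX k3)
    _ = _ := by ring

end Params

/-! ## Proof of Prop. 5.9, second item (arXiv (5.38)) -/

section Assembly

/-- **The material-derivative bound for the conjugated stress holds** (BDSV Prop. 5.9, second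
item, arXiv (5.38): for `t ∈ Ĩ_i` and `N ≥ 0`, `‖D_{t,q}R̃_{q,i}‖_N ≲ τ_q^{-1}ℓ^{-N}`). Proof as
printed (§5.5): Leibniz expansion of `D_{t,q}(∇Φ_i M ∇Φ_iᵀ)`, `M = R_{q,i}/ρ_{q,i} = Id - ρ_q⁻¹R̊̄_q`
(mass `∑∫η_j² = 1` on `supp R̊̄_q`), with `D_{t,q}∇Φ_i = -∇Φ_iDv̄_q` bounded through (2.19) and the
all-orders flow bound (5.23) on the window around `Ĩ_i` (smallness `τ_qδ_q^{1/2}λ_q = ℓ^{2α} → 0`),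
`D_{t,q}M` through (2.20), (2.21), `ρ_q ≥ δ_{q+1}λ_q^{-α}/8` (5.15) and `|ρ_q'| ≲ 1 + δ_{q+1}δ_q^{1/2}λ_q`
(5.18), and the parameter inequalities `δ_q^{1/2}λ_q ≤ τ_q⁻¹ = δ_q^{1/2}λ_qℓ^{-2α}`, `λ_q^αℓ^α ≤ 1`,
`λ_q^α ≤ ℓ^{-α}`, `δ_{q+1}⁻¹ ≤ δ_q^{1/2}λ_q` (`a` large, `b < (1-β)/(2β)`). The threshold `α₀` is
`2βb(b-1)` (for (5.15)), `N̄ = N`, and the constant depends on `N` and `C_in` only.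
[cite: BuckmasterEtAl2018, Prop. 5.9 (arXiv (5.38))] -/
theorem tildeRTransportBound_holds : tildeRTransportBound := by
  intro c₀ _hc₀ Cη β hβ _hβ3 b hb1 hb2
  -- `α₀ = 2βb(b-1)` (for the lower bound (5.15) on `ρ_q`)
  have hb0 : 0 < b := by linarith
  have hb1' : 0 < b - 1 := by linarith
  refine ⟨2 * β * b * (b - 1), mul_pos (mul_pos (mul_pos two_pos hβ) hb0) hb1', ?_⟩
  intro α hα hαb N
  -- the continuous (bi)linear maps of the matrix plumbing
  obtain ⟨Bm, hBm⟩ := exists_matrixMulCLM_pi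
  obtain ⟨Lt, hLt⟩ := exists_transposeCLM_pi
  obtain ⟨Loc, hLoc⟩ := exists_ofColsCLM_pi
  obtain ⟨Lj, hLj⟩ := exists_jacCLM_pi
  -- the identity matrix on the coordinate carrier
  set E₀ : Fin 3 → Fin 3 → ℝ := (1 : Matrix (Fin 3) (Fin 3) ℝ) with hE₀def
  -- the flow constant
  obtain ⟨K, hK2, hK⟩ := displacement_allOrders (d := Fin 3) N
  refine ⟨N, ?_⟩
  intro Cin C₀
  -- thresholds
  obtain ⟨a₁, ha₁1, ha₁⟩ :=
    exists_threshold_mollScale_rpow_le hβ.le hb1.le hα (5 / 3 * K * |Cin|) one_pos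
  obtain ⟨a₂, ha₂1, ha₂⟩ := exists_threshold_four_amp (β := β) hb1 hαb
  obtain ⟨a₃, ha₃1, ha₃⟩ := exists_threshold_amp_succ_inv_le hβ hb1 hb2
  -- constants: `Cp = |C_in|`, the Leibniz factor `Pm`, and `c₁, c₂, c₃` (opaque names)
  set Cp : ℝ := |Cin| with hCpdef
  have hCp : 0 ≤ Cp := abs_nonneg Cin
  obtain ⟨cL, hcL⟩ : ∃ cL : ℝ, cL = ‖ContinuousLinearMap.compL ℝ (EuclideanSpace ℝ (Fin 3))
      (EuclideanSpace ℝ (Fin 3)) (EuclideanSpace ℝ (Fin 3))‖ := ⟨_, rfl⟩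
  have hcL0 : 0 ≤ cL := by rw [hcL]; positivity
  obtain ⟨c₁, hc₁⟩ : ∃ c₁ : ℝ, c₁ = ‖Lj‖ * (Cp + 3 ^ N * (N + 1) * cL * 1 * Cp) := ⟨_, rfl⟩
  have hc₁0 : 0 ≤ c₁ := by
    rw [hc₁]
    exact mul_nonneg (norm_nonneg Lj) (add_nonneg hCp
      (mul_nonneg (mul_nonneg (mul_nonneg (by positivity) hcL0) zero_le_one) hCp))
  obtain ⟨c₂, hc₂⟩ : ∃ c₂ : ℝ, c₂ = ‖E₀‖ + 24 * ‖Loc‖ * Cp := ⟨_, rfl⟩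
  have hc₂0 : 0 ≤ c₂ := by
    rw [hc₂]
    exact add_nonneg (norm_nonneg _) (mul_nonneg (mul_nonneg (by norm_num) (norm_nonneg _)) hCp)
  obtain ⟨c₃, hc₃⟩ : ∃ c₃ : ℝ, c₃ = (88 * Cp + 384 * Cp ^ 3) * ‖Loc‖ := ⟨_, rfl⟩
  have hc₃0 : 0 ≤ c₃ := by
    rw [hc₃]
    exact mul_nonneg (add_nonneg (mul_nonneg (by norm_num) hCp)
      (mul_nonneg (by norm_num) (pow_nonneg hCp 3))) (norm_nonneg _)
  have hPm : 0 ≤ (3 : ℝ) ^ N * (N + 1) * ‖Bm‖ := by positivity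
  refine ⟨3 ^ N * (N + 1) * ‖Bm‖ * (3 ^ N * (N + 1) * ‖Bm‖ * c₁ * c₂) * (‖Lt‖ * 18) +
      3 ^ N * (N + 1) * ‖Bm‖ * (3 ^ N * (N + 1) * ‖Bm‖ * 18 * c₃) * (‖Lt‖ * 18) +
      3 ^ N * (N + 1) * ‖Bm‖ * (3 ^ N * (N + 1) * ‖Bm‖ * 18 * c₂) * (‖Lt‖ * c₁),
    max a₁ (max a₂ a₃), lt_max_of_lt_left ha₁1, ?_⟩
  intro a ha S H 𝒟 i
  -- parameters
  have haa₁ : a₁ ≤ a := (le_max_left _ _).trans ha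
  have haa₂ : a₂ ≤ a := ((le_max_left _ _).trans (le_max_right _ _)).trans ha
  have haa₃ : a₃ ≤ a := ((le_max_right _ _).trans (le_max_right _ _)).trans ha
  have ha1 : 1 ≤ a := ha₁1.le.trans haa₁
  have hK0 : 0 ≤ K := zero_le_two.trans hK2
  set ℓ := mollScale β α a b S.q with hℓdef
  set τ := Params.τ ⟨β, α, a, b⟩ S.q with hτdef
  have hℓ : 0 < ℓ := mollScale_pos ha1 _
  have hℓ1 : ℓ ≤ 1 := mollScale_le_one_of_params ha1 hb1.le hβ.le hα.le S.q
  have hτ : 0 < τ := glueScale_pos ha1 _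
  have hT : 0 < S.T := H.pos_T
  have hf := freq_pos (b := b) ha1 S.q
  have hδ₁ := amp_pos (β := β) (b := b) ha1 (S.q + 1)
  set W : ℝ := Real.sqrt (amp β a b S.q) * freq a b S.q with hWdef
  have hW0 : 0 ≤ W := mul_nonneg (Real.sqrt_nonneg _) hf.le
  obtain ⟨X, hX⟩ : ∃ X : ℝ, X = (ℓ ^ α)⁻¹ ^ 2 := ⟨_, rfl⟩
  -- the standing hypotheses with the nonnegative constant `Cp = |C_in|`
  have H' : PerturbationHypotheses ⟨β, α, a, b⟩ S N Cp C₀ := H.mono_const ha1 (le_abs_self Cin)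
  have hvsm : Torus.IsSmoothSpaceTimeOn (Icc 0 S.T) S.vbar := H.eulerReynolds.smooth_velocity
  have hRsm : Torus.IsSmoothSpaceTimeOn (Icc 0 S.T) S.Rbar := H.eulerReynolds.smooth_stress
  have hDsm : Torus.IsSmoothSpaceTimeOn (Icc 0 S.T) (𝒟.D i) := (𝒟.flow i).smooth
  -- thresholds at this `a`
  have hsmall0 : 5 / 3 * K * |Cin| * ℓ ^ (2 * α) ≤ 1 := ha₁ a haa₁ S.q
  have h4 : 4 * amp β a b (S.q + 2) ≤ amp β a b (S.q + 1) * freq a b S.q ^ (-α) := ha₂ a haa₂ S.q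
  have hδW : (amp β a b (S.q + 1))⁻¹ ≤ W := ha₃ a haa₃ S.q
  -- parameter inequalities
  have hLE : freq a b S.q ^ α * ℓ ^ α ≤ 1 :=
    freq_rpow_mul_mollScale_rpow_le_one' ha1 hb1.le hβ.le hα.le S.q
  have hLE' : freq a b S.q ^ α ≤ (ℓ ^ α)⁻¹ := by
    rw [← Real.rpow_neg hℓ.le]
    exact freq_rpow_le_mollScale_rpow_neg ha1 hb1.le hβ.le hα.le S.q
  have hEpos : 0 < ℓ ^ α := Real.rpow_pos_of_pos hℓ _
  have hE1 : ℓ ^ α ≤ 1 := Real.rpow_le_one hℓ.le hℓ1 hα.le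
  have hEi1 : 1 ≤ (ℓ ^ α)⁻¹ := (one_le_inv₀ hEpos).2 hE1
  have hX1 : 1 ≤ X := by rw [hX]; nlinarith
  have hX2 : (ℓ ^ α)⁻¹ ^ 2 = ℓ ^ (-(2 * α)) := by
    rw [← Real.rpow_neg hℓ.le, ← Real.rpow_natCast, ← Real.rpow_mul hℓ.le]
    congr 1
    push_cast
    ring
  have hτinv : τ⁻¹ = W * X := by
    rw [hX, hX2, hWdef]
    change (glueScale β α a b S.q)⁻¹ = _
    rw [glueScale_inv_eq ha1]
  -- ### the graded inputs on `[0,T]`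
  have hvg : GradedSupLE (Icc 0 S.T) (gradField S.vbar) N (Cp * W) ℓ :=
    H'.gradedSupLE_gradField_vbar le_rfl
  have hRb : GradedSupLE (Icc 0 S.T) (fun t x => Loc (S.Rbar t x)) N
      (‖Loc‖ * (3 * (Cp * (amp β a b (S.q + 1) * ℓ ^ α)))) ℓ :=
    H'.gradedSupLE_clm_Rbar ha1 le_rfl Loc
  have hDRb : GradedSupLE (Icc 0 S.T) (fun t x => Loc (advectiveDeriv S.T S.vbar S.Rbar t x)) N
      (‖Loc‖ * (3 * (Cp * (amp β a b (S.q + 1) * W * (ℓ ^ α)⁻¹)))) ℓ := by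
    have h := H'.gradedSupLE_clm_advectiveDeriv_Rbar ha1 le_rfl Loc
    refine h.mono hℓ (le_of_eq ?_)
    change ‖Loc‖ * (3 * (Cp * (amp β a b (S.q + 1) * Real.sqrt (amp β a b S.q) * freq a b S.q *
      ℓ ^ (-α)))) = _
    rw [Real.rpow_neg hℓ.le, hWdef]
    ring
  -- ### `ρ_q⁻¹`
  set θ : ℝ → ℝ := fun t => (rhoQ ⟨β, α, a, b⟩ S t)⁻¹ with hθdef
  set θ' : ℝ → ℝ := fun t => -rhoQDeriv S t / rhoQ ⟨β, α, a, b⟩ S t ^ 2 with hθ'def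
  have hθc : ContDiffOn ℝ ∞ θ (Icc 0 S.T) := H'.contDiffOn_inv_rhoQ ha1 h4
  have hθd : ∀ t ∈ Icc 0 S.T, HasDerivWithinAt θ (θ' t) (Icc 0 S.T) t := fun t ht =>
    H'.hasDerivWithinAt_inv_rhoQ ha1 h4 ht
  set m : ℝ := 8 * freq a b S.q ^ α / amp β a b (S.q + 1) with hmdef
  have hm0 : 0 ≤ m := div_nonneg (mul_nonneg (by norm_num) (Real.rpow_nonneg hf.le _)) hδ₁.le
  have hm : ∀ t ∈ Icc 0 S.T, |θ t| ≤ m := fun t ht => H'.abs_inv_rhoQ_le ha1 h4 ht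
  set ρmax : ℝ := (1 + 6 * (Cp * (amp β a b (S.q + 1) * ℓ ^ α)) * (Cp * W)) / 3 with hρmaxdef
  have hρmax0 : 0 ≤ ρmax :=
    div_nonneg (add_nonneg zero_le_one (mul_nonneg (mul_nonneg (by norm_num)
      (mul_nonneg hCp (mul_nonneg hδ₁.le hEpos.le))) (mul_nonneg hCp hW0))) zero_le_three
  set m' : ℝ := ρmax * m ^ 2 with hm'def
  have hm'0 : 0 ≤ m' := mul_nonneg hρmax0 (sq_nonneg _)
  have hm' : ∀ t ∈ Icc 0 S.T, |θ' t| ≤ m' := by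
    intro t ht
    have h1 := H'.abs_invRhoQDeriv_le ha1 h4 ht
    have h2 := H'.abs_rhoQDeriv_le hCp ha1 ht
    exact h1.trans (mul_le_mul_of_nonneg_right h2 (sq_nonneg _))
  -- ### `M` and `D_t M` on `[0,T]`
  have hAR0 : 0 ≤ ‖Loc‖ * (3 * (Cp * (amp β a b (S.q + 1) * ℓ ^ α))) :=
    mul_nonneg (norm_nonneg _) (mul_nonneg zero_le_three (mul_nonneg hCp (mul_nonneg hδ₁.le hEpos.le)))
  have hAD0 : 0 ≤ ‖Loc‖ * (3 * (Cp * (amp β a b (S.q + 1) * W * (ℓ ^ α)⁻¹))) :=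
    mul_nonneg (norm_nonneg _) (mul_nonneg zero_le_three (mul_nonneg hCp
      (mul_nonneg (mul_nonneg hδ₁.le hW0) (zero_le_one.trans hEi1))))
  have hMb : GradedSupLE (Icc 0 S.T) (fun t x => E₀ - θ t • Loc (S.Rbar t x)) N c₂ ℓ := by
    have h := gradedSupLE_normStress E₀ hℓ hℓ1 (fun t ht => hRsm.isSmooth_slice ht) hRb hAR0 hm hm0
    refine h.mono hℓ ?_
    rw [hc₂]
    refine add_le_add le_rfl ?_
    -- `m · ‖Loc‖ 3 Cp δ ℓ^α = 24 ‖Loc‖ Cp (λ^α ℓ^α) ≤ 24 ‖Loc‖ Cp`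
    have e : m * (‖Loc‖ * (3 * (Cp * (amp β a b (S.q + 1) * ℓ ^ α)))) =
        24 * ‖Loc‖ * Cp * (freq a b S.q ^ α * ℓ ^ α) := by
      rw [hmdef]
      field_simp
      ring
    rw [e]
    exact mul_le_of_le_one_right (mul_nonneg (mul_nonneg (by norm_num) (norm_nonneg _)) hCp) hLE
  have hdMb : GradedSupLE (Icc 0 S.T)
      (advectiveDeriv S.T S.vbar (fun t x => E₀ - θ t • Loc (S.Rbar t x))) N (c₃ * (W * X)) ℓ := by
    have h := gradedSupLE_advectiveDeriv_normStress hT E₀ hθc hθd Loc hvsm hRsm hℓ hRb hAR0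
      hDRb hAD0 hm hm0 hm' hm'0
    refine h.mono hℓ ?_
    have key := normStressDeriv_amplitude_le (L := freq a b S.q ^ α) (E := ℓ ^ α)
      (δ := amp β a b (S.q + 1)) (W := W) (C := Cp) (c := ‖Loc‖)
      (Real.rpow_nonneg hf.le _) hEpos hE1 hLE hLE' hδ₁ hδW hCp (norm_nonneg _)
    rw [hc₃, hX]
    exact key
  -- ### the bound on `Ĩ_i`: through the window around it
  have key : ∀ t ∈ tildeInterval S.T τ i,
      Torus.eContDiffHolderNorm N 0
          (advectiveDeriv S.T S.vbar (tildeR ⟨β, α, a, b⟩ S 𝒟.cut.η 𝒟.D i) t) ≤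
        ENNReal.ofReal ((3 ^ N * (N + 1) * ‖Bm‖ * (3 ^ N * (N + 1) * ‖Bm‖ * c₁ * c₂) * (‖Lt‖ * 18) +
          3 ^ N * (N + 1) * ‖Bm‖ * (3 ^ N * (N + 1) * ‖Bm‖ * 18 * c₃) * (‖Lt‖ * 18) +
          3 ^ N * (N + 1) * ‖Bm‖ * (3 ^ N * (N + 1) * ‖Bm‖ * 18 * c₂) * (‖Lt‖ * c₁)) *
            (τ⁻¹ * ℓ ^ (-(N : ℝ)))) := by
    intro t ht
    obtain ⟨hab', hsub, ht₀, hlen, hIsub⟩ := tildeInterval_window hT hτ i ht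
    have ht' := hIsub ht
    -- the displacement bound on the window
    set Λ : ℝ := Cp * W with hΛdef
    have hΛ0 : 0 ≤ Λ := mul_nonneg hCp hW0
    set Mℓ : ℝ := ℓ⁻¹ with hMℓdef
    have hMℓ1 : 1 ≤ Mℓ := (one_le_inv₀ hℓ).2 hℓ1
    have hMℓpow : ∀ n : ℕ, ℓ ^ (-(n : ℝ)) = Mℓ ^ n := fun n => by
      rw [Real.rpow_neg hℓ.le, Real.rpow_natCast, hMℓdef, inv_pow]
    have hΛτ : Λ * τ = Cp * ℓ ^ (2 * α) :=
      velocityBound_mul_tau (P := ⟨β, α, a, b⟩) (Cin := Cp) ha1 S.q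
    have hvb : ∀ s ∈ Icc 0 S.T, ∀ j ≤ N,
        Torus.eContDiffHolderNorm (j + 1) 0 (S.vbar s) ≤ ENNReal.ofReal (Λ * Mℓ ^ j) := by
      intro s hs j hj
      refine (H'.velocity j hj s hs).trans (le_of_eq ?_)
      change ENNReal.ofReal (Cp * (Real.sqrt (amp β a b S.q) * freq a b S.q * ℓ ^ (-(j : ℝ)))) = _
      rw [hMℓpow j, hΛdef, hWdef]
      ring_nf
    have heq0 : ∀ s ∈ Icc 0 S.T, ∀ x, Torus.timeDerivWithin (Icc 0 S.T) (𝒟.D i) s x +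
        Torus.convect (S.vbar s) (𝒟.D i s) x = -S.vbar s x :=
      fun s hs x => eq_neg_of_add_eq_zero_left ((𝒟.flow i).transport s hs x)
    have hsmall : (min S.T (((i : ℝ) + 1) * τ + τ / 3) - max 0 ((i : ℝ) * τ - τ / 3)) * Λ * K ≤ 1 := by
      calc (min S.T (((i : ℝ) + 1) * τ + τ / 3) - max 0 ((i : ℝ) * τ - τ / 3)) * Λ * K
          ≤ (5 / 3 * τ) * Λ * K := mul_le_mul_of_nonneg_right (mul_le_mul_of_nonneg_right hlen hΛ0) hK0
        _ = 5 / 3 * K * (Λ * τ) := by ring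
        _ = 5 / 3 * K * |Cin| * ℓ ^ (2 * α) := by rw [hΛτ, hCpdef]; ring
        _ ≤ 1 := hsmall0
    have hKLΛ : K * ((min S.T (((i : ℝ) + 1) * τ + τ / 3) - max 0 ((i : ℝ) * τ - τ / 3)) * Λ) ≤ 1 := by
      calc K * ((min S.T (((i : ℝ) + 1) * τ + τ / 3) - max 0 ((i : ℝ) * τ - τ / 3)) * Λ)
          = (min S.T (((i : ℝ) + 1) * τ + τ / 3) - max 0 ((i : ℝ) * τ - τ / 3)) * Λ * K := by ring
        _ ≤ 1 := hsmall
    have heq' := transport_restrict hab' hsub hDsm heq0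
    have hDb : ∀ s ∈ Icc (max 0 ((i : ℝ) * τ - τ / 3)) (min S.T (((i : ℝ) + 1) * τ + τ / 3)), ∀ n ≤ N,
        Torus.eContDiffHolderNorm (n + 1) 0 (𝒟.D i s) ≤ ENNReal.ofReal (ℓ ^ (-(n : ℝ))) := by
      intro s hs n hn
      have h := hK hab' (hvsm.mono hsub) (hDsm.mono hsub) heq' ht₀ (𝒟.flow i).anchor hΛ0 hMℓ1
        (fun s hs j hj => hvb s (hsub hs) j hj) hsmall s hs n hn
      refine h.trans (ENNReal.ofReal_le_ofReal ?_)
      rw [hMℓpow n]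
      calc K * ((min S.T (((i : ℝ) + 1) * τ + τ / 3) - max 0 ((i : ℝ) * τ - τ / 3)) * Λ) * Mℓ ^ n
          ≤ 1 * Mℓ ^ n := mul_le_mul_of_nonneg_right hKLΛ (zero_le_one.trans (one_le_pow₀ hMℓ1))
        _ = Mℓ ^ n := one_mul _
    -- graded bounds for `∇Φ_i`, `∇D_i`, `D_t ∇Φ_i` on the window
    have hDs : ∀ s ∈ Icc (max 0 ((i : ℝ) * τ - τ / 3)) (min S.T (((i : ℝ) + 1) * τ + τ / 3)),
        IsSmooth (𝒟.D i s) := fun s hs => hDsm.isSmooth_slice (hsub hs)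
    have hGb := gradedSupLE_gradPhi_of_disp hℓ hℓ1 hDs hDb
    have hDg := gradedSupLE_gradField_of_disp hDb
    have htr : ∀ s ∈ Icc 0 S.T, ∀ x, advectiveDeriv S.T S.vbar (𝒟.D i) s x = -S.vbar s x :=
      fun s hs x => (𝒟.flow i).advectiveDeriv_eq hs x
    have hdGb : GradedSupLE (Icc (max 0 ((i : ℝ) * τ - τ / 3)) (min S.T (((i : ℝ) + 1) * τ + τ / 3)))
        (advectiveDeriv S.T S.vbar (fun s y => gradPhi 𝒟.D i s y)) N (c₁ * W) ℓ := by
      have h := gradedSupLE_advectiveDeriv_gradPhi hT hLj hvsm hDsm htr hsub hℓ hΛ0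
        (hvg.anti hsub) hDg
      refine h.mono hℓ (le_of_eq ?_)
      rw [hc₁, hcL, hΛdef]
      ring
    -- graded bounds for `M`, `D_t M` on the window
    have hMw := hMb.anti hsub
    have hdMw := hdMb.anti hsub
    -- the conjugated stress `G M Gᵀ` on the window
    have hGsm : Torus.IsSmoothSpaceTimeOn (Icc 0 S.T) (fun s y => (gradPhi 𝒟.D i s y : Fin 3 → Fin 3 → ℝ)) :=
      contDiffOn_pi' fun k => contDiffOn_pi' fun l =>
        isSmoothSpaceTimeOn_gradPhi hT (fun j => (𝒟.flow j).smooth) i k l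
    have hMsm : Torus.IsSmoothSpaceTimeOn (Icc 0 S.T) (fun s y => E₀ - θ s • Loc (S.Rbar s y)) :=
      (Torus.isSmoothSpaceTimeOn_const (isSmooth_const _) _).sub
        ((isSmoothSpaceTimeOn_of_time hθc).smul (hRsm.clm_comp Loc))
    have hconj := gradedSupLE_advectiveDeriv_conj hT Bm Lt hvsm hGsm hMsm hsub hℓ (by norm_num)
      (mul_nonneg hc₁0 hW0) hc₂0 (mul_nonneg hc₃0 (mul_nonneg hW0 (zero_le_one.trans hX1)))
      hGb hdGb hMw hdMw
    -- `R̃_{q,i} = G M Gᵀ` on `[0,T]`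
    have hRt : ∀ s ∈ Icc 0 S.T, ∀ y, tildeR ⟨β, α, a, b⟩ S 𝒟.cut.η 𝒟.D i s y =
        Bm (Bm (gradPhi 𝒟.D i s y) (E₀ - θ s • Loc (S.Rbar s y))) (Lt (gradPhi 𝒟.D i s y)) := by
      intro s hs y
      rw [hBm, hBm, hLt, hLoc, 𝒟.tildeR_eq H ha1 i hs y]
      rfl
    have hfinal := (hconj.congr fun s hs y =>
      (advectiveDeriv_congr (T := S.T) (v := S.vbar) hRt (hsub hs) y).symm).le ht' le_rfl
    refine hfinal.trans (ENNReal.ofReal_le_ofReal ?_)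
    -- the amplitude is at most `C τ⁻¹`
    rw [hτinv]
    have hmain := conjDeriv_amplitude_le hPm (norm_nonneg Lt) hc₁0 hc₂0 hc₃0 hW0 hX1
    refine le_trans (mul_le_mul_of_nonneg_right hmain (Real.rpow_nonneg hℓ.le _)) (le_of_eq ?_)
    ring
  exact fun t ht => key t ht

end Assembly

end BDSV

end Literature.Analysis.FluidPDE
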